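import Summits.ValiantsHypothesis.ValiantsHypothesis.Theorems.KPlusLogSqLawTropicalShiftThreeChain
import Summits.ValiantsHypothesis.ValiantsHypothesis.Theorems.LacunarySymmetroidMatrixDescartesCensusFrame

/-!
# Route «KPlusLogSqLaw», crux `Lifting` — the registered stub `stub_liftRungThree` (LIFT at `K = 3`, all `m`)

HONEST FRAMING.  This file proves, BY NAME AND SIGNATURE, the registered stub `stub_liftRungThree` of the crux
`Summit.ValiantsHypothesis.ValiantsHypothesis.Theses.KPlusLogSqLaw.Lifting` (ledger item `stmt-ValiantsHypothesis-19772`,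
route `KPlusLogSqLaw`, skeleton `Cruxes/Lifting/Lines/birth.lean`; object-search cell `pub-symmetroid`, seat
val-sym-lift-p3, 2026-08-26):

  `stub_liftRungThree : ∀ m n : ℕ, TropRow m 3 n → RealRootLawAt m 3 (2 ^ (3 * 3) * (n + 1))`,

where `TropRow` is the skeleton's local name for the tree's tropical census row `TropicalCensus.TropRootLawAt` (the two
are `δ`-equal — same body — so this theorem closes the skeleton's `sorry` by `exact`).  It is the BC5 rung «LIFT at
`K = 3` for all `m`» of the route, inside the Descartes-known strip: format-level lifting at `K = 3` costs nothing because
the tropical census row `(m, 3)` is counting-tight minus one FROM BELOW — `TropRootLawAt m 3 n → C(m+2,2) − 2 ≤ n`, the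
explicit SHIFT-THREE family (`TropicalCensus.choose_sub_two_le_of_tropRootLawAt_three`, files
`…TropicalShiftThree{Defs,,Chain}.lean`) — while the real row obeys Descartes,
`Census.realRootLawAt_descartes m 3 : RealRootLawAt m 3 (2·C(m+2,m) − 1)`, and `2·C(m+2,2) − 1 ≤ 2^9·(C(m+2,2) − 1)`
(for `m = 0`: `1 ≤ 512`).  The stub is plan-only in the skeleton (not a hypothesis of `Lifting_of`): landing it does not
close `Lifting`, whose regime stubs `stub_liftThin` / `stub_liftFat` remain OPEN conjectures of the cell.  Nothing here
bears on `TropicalB`, `KPlusLogSqLaw`, `MatrixDescartes` or `VP ≠ VNP`.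
-/

set_option linter.dupNamespace false
set_option autoImplicit false

namespace Summit.ValiantsHypothesis.ValiantsHypothesis.Theorems.KPlusLogSqLaw

open Summit.ValiantsHypothesis.ValiantsHypothesis.Theorems.LacunarySymmetroidMatrixDescartes (RealRootLawAt)
open Summit.ValiantsHypothesis.ValiantsHypothesis.Theorems.LacunarySymmetroidMatrixDescartes.TropicalCensus
  renaming TropRootLawAt → TropRow

/-- **LIFT, rung `K = 3` (all `m`, constant `2^9`)** — the registered stub `stub_liftRungThree` of crux `Lifting`:
if the tropical census row `(m, 3)` is bounded by `n` then every real symmetric three-term `m × m` lacunary pencil has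
at most `2^9·(n+1)` distinct real zeros of its determinant.  Proof: `C(m+2,2) − 2 ≤ n` (SHIFT-THREE) and Descartes
`ζ(m,3) ≤ 2·C(m+2,2) − 1`. -/
theorem stub_liftRungThree : ∀ m n : ℕ, TropRow m 3 n → RealRootLawAt m 3 (2 ^ (3 * 3) * (n + 1)) := by
  intro m n h
  have h1 := LacunarySymmetroidMatrixDescartes.TropicalCensus.choose_sub_two_le_of_tropRootLawAt_three m n h
  refine LacunarySymmetroidMatrixDescartes.Census.realRootLawAt_mono ?_
    (LacunarySymmetroidMatrixDescartes.Census.realRootLawAt_descartes m 3 (by norm_num))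
  have h2 : Nat.choose (m + 3 - 1) m = Nat.choose (m + 2) 2 := by
    rw [show m + 3 - 1 = m + 2 from rfl]
    exact Nat.choose_symm_add
  have h3 : 1 ≤ Nat.choose (m + 2) 2 := Nat.choose_pos (by omega)
  rw [h2, show 2 ^ (3 * 3) = 512 by norm_num]
  omega

end Summit.ValiantsHypothesis.ValiantsHypothesis.Theorems.KPlusLogSqLaw
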